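import Summits.BirchSwinnertonDyer.BirchSwinnertonDyer.Theorems.ByReductionTypeAtTwoTowerNoFiniteSubmoduleOfCasselsTateAlternating
import Literature.NumberTheory.EllipticCurves.ZpCorankCyclotomicPrimePow
import Literature.NumberTheory.EllipticCurves.ShaCorankBaseChange
import HarnessLib

/-!
# Route `ByReductionTypeAtTwo` (rung K4), crux `SupersingularRankZeroAtTwo` (item stmt-BirchSwinnertonDyer-19097), slot 4a
# `stub_classicalNF` (h11): the `ℤ_p`-CORANK OF `Sel_{p^∞}(E/K_n)` ALONG A `ℤ_p`-TOWER IS BOUNDED BY THE LAYER-`0` CORANK PLUS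
# THE CORANKS OF THE FAITHFUL PARTS — kernel glue (G2)+(G3) of the pen's BRIEF-hKR behind tower-1's binder
# `hKR : ∃ B, ∀ n, zpCorank (W.selmerLayer κ n) p ≤ B` of ★★ p823354

HONEST FRAMING (cell `bsd-2adic`, run/shared/lean/pub/bsd-2adic/, seat `bsd-2adic-ss-1` GEN 24 = LEAD lineage of 19097;
HUMAN RULINGS D-0036 / D-0054 / D-0074): THEOREMS ONLY (no definition, no named fact, no instance, no `sorry`, axioms the
standard trio); PURE ALGEBRA over the tree's SUBGROUP model of the Selmer tower (`W.selmerLayer κ n ⊆ H¹(Gal(K̄/K_n), E[p^∞])`,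
Galois action `W.conjH1`, restriction `W.resOfLe`, corestriction `W.coresLayer`); ANY number field `K`, ANY prime `p`, ANY
`ℤ_p`-extension `κ` with topological generator `γ`; NO control theorem, NO inflation–restriction, NO arithmetic input.
Closes no route item; nothing booked; BSD is not proved by any of this.

## What is proved

Write `Sel_n := W.selmerLayer κ n` and let `σ_n` be the action of `γ^{pⁿ}` (a generator of `Gal(K_{n+1}/K_n)`, cyclic of order
`p`) on `Sel_{n+1}`, displayed as an additive endomorphism `σ` of the layer with `↑(σ x) = conj_{γ^{pⁿ}} x` (binder `hσ`; such
a `σ` always exists, `exists_layerEnd_eq_conjH1`).  Its norm `N_{σ_n} = Σ_{i<p} σ_n^i = Φ_{p^{n+1}}(γ)` cuts out the FAITHFUL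
part `ker N_{σ_n} ⊆ Sel_{n+1}` (the `χ`-part for the characters of `Gal(K_{n+1}/K)` of exact order `p^{n+1}`).

* `zpCorank_selmerLayer_succ_le_add_zpCorank_kerNorm` — ONE STEP:
  `zpCorank Sel_{n+1} ≤ zpCorank Sel_n + zpCorank (ker N_{σ_n})`.  Proof: the tree's cyclic engine
  `zpCorank_eq_zpCorank_fixedSub_add_zpCorank_kerNorm` (`σ^p = 1` ⟹ `corank A = corank A^σ + corank ker N_σ`) and the bound
  `zpCorank (Sel_{n+1})^{σ_n} ≤ zpCorank Sel_n` from the CORESTRICTION `cor : (Sel_{n+1})^{σ_n} → Sel_n`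
  (`coresLayer_mem_selmerLayer`), whose kernel is killed by `p` because `res ∘ cor = Σ_{i<p} conj_{γ^{pⁿ i}} = N_{σ_n}`
  (`resOfLe_coresOfLe_eq_sum`, `bijective_layerCosetRep`) is multiplication by `p` on `σ_n`-fixed classes; a map with finite
  kernel does not increase the corank (`zpCorank_le_of_finite_ker`).
* `zpCorank_selmerLayer_le_add_sum_zpCorank_kerNorm` — TELESCOPED:
  `zpCorank Sel_n ≤ zpCorank Sel_0 + Σ_{k<n} zpCorank (ker N_{σ_k})`.
* `exists_forall_zpCorank_selmerLayer_le_of_eventually_finite_kerNorm` — if the faithful parts are finite from some level on,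
  the coranks are BOUNDED: `(∃ k₀, ∀ k ≥ k₀, Finite (ker N_{σ_k})) → ∃ B, ∀ n, zpCorank Sel_n ≤ B`.
* `exists_forall_zpCorank_selmerLayer_le_of_eventually_finite_faithfulPart` — the same with NO displayed endomorphism: the
  hypothesis is that for `k ≥ k₀` the set `{x ∈ Sel_{k+1} | Σ_{i<p} conj_{γ^{p^k i}} x = 0}` is contained in a finite set.

For `E/ℚ` good supersingular at `2` along the cyclotomic `ℤ₂`-tower the last hypothesis is exactly what Kato's Cor. 14.3 (1)
(`L(E,χ,1) ≠ 0 ⟹ Sel(E/ℚ_n)^{(χ)}` finite, every `p` incl. `2`) gives for the faithful characters `χ` of `Gal(ℚ_{k+1}/ℚ)` once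
Rohrlich's theorem (tree THEOREM `Rohrlich1984_nonvanishing_twists_holds`) makes `L(E,χ,1) ≠ 0` for all `χ` of `2`-power
conductor beyond a finite set — the remaining glue (G1b: Kato 14.3 (1) on the layers; G4: assembly) is NOT in this file.

References: R. Greenberg, *Iwasawa theory for elliptic curves*, LNM 1716 (1999), §1 (coranks, finite kernels) and §3;
K. Kato, Astérisque 295 (2004), Thm. 14.2 / Cor. 14.3 (p. 235); D. Rohrlich, Invent. Math. 75 (1984) 409–423;
J.-P. Serre, *Galois Cohomology*, I.§2.4 (`res ∘ cor`); Y. Hachimori, K. Matsuno, Proc. AMS 128 (2000) 2539–2541.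
-/

set_option autoImplicit false
-- the Theorems namespace of this sub repeats the summit name by design (D-0017 nested layout: Summit.<S>.<Sub>)
set_option linter.dupNamespace false

noncomputable section

open scoped Classical AddSubgroup

universe u

namespace Summit.BirchSwinnertonDyer.BirchSwinnertonDyer.Theorems.TowerCorank

open Field WeierstrassCurve Literature.NumberTheory.EllipticCurves
  Summit.BirchSwinnertonDyer.BirchSwinnertonDyer.Theorems.TowerHaMa

variable {K : Type u} [Field K] [NumberField K] (W : WeierstrassCurve K) [W.IsElliptic] (p : ℕ) [hp : Fact p.Prime]
  (κ : ZpExtension K p) {γ : Field.absoluteGaloisGroup K}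

/-! ## §1 The generator `σ_n = conj_{γ^{pⁿ}}` of `Gal(K_{n+1}/K_n)` on `Sel_{p^∞}(E/K_{n+1})` -/

omit [W.IsElliptic] in
/-- Such a displayed endomorphism always exists: `conj_{γ^{pⁿ}}` preserves `Sel_{p^∞}(E/K_{n+1})`
(`map_conjH1_selmerGroupOver_le_holds`). Greenberg (1999), §1 (the Selmer group is a `Gal`-module). [cite: GreenbergLNM1716, §1] -/
theorem exists_layerEnd_eq_conjH1 (g : Field.absoluteGaloisGroup K) (m : ℕ) :
    ∃ σ : AddMonoid.End (W.selmerLayer κ m),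
      ∀ x : W.selmerLayer κ m, ((σ x : W.selmerLayer κ m) : W.subgroupH1 p (κ.layerSubgroup m)) =
        W.conjH1 p (κ.layerSubgroup m) g x :=
  ⟨((W.conjH1 p (κ.layerSubgroup m) g).comp (W.selmerLayer κ m).subtype).codRestrict (W.selmerLayer κ m)
      fun x ↦ W.map_conjH1_selmerGroupOver_le_holds p (κ.layerSubgroup m) g ⟨x, x.2, rfl⟩,
    fun _ ↦ rfl⟩

omit [NumberField K] [W.IsElliptic] hp in
/-- Powers of conjugation: `conj_{g^i} = (conj_g)^i` pointwise (`conjH1_one_holds`, `conjH1_mul_holds`). [folklore] -/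
theorem conjH1_pow_apply (H : Subgroup (Field.absoluteGaloisGroup K)) [H.Normal] (g : Field.absoluteGaloisGroup K)
    (i : ℕ) (x : W.subgroupH1 p H) :
    W.conjH1 p H (g ^ i) x = (W.conjH1 p H g)^[i] x := by
  induction i with
  | zero => rw [pow_zero, Function.iterate_zero, id_eq, W.conjH1_one_holds p H, AddMonoidHom.id_apply]
  | succ i ih =>
      rw [pow_succ', W.conjH1_mul_holds p H, AddMonoidHom.comp_apply, ih, Function.iterate_succ_apply']

omit [W.IsElliptic] in
/-- For a displayed `σ` with `↑(σ x) = conj_g x`: `↑(σ^i x) = conj_{g^i} x`. [folklore] -/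
theorem coe_layerEnd_pow_apply {m : ℕ} {g : Field.absoluteGaloisGroup K} (σ : AddMonoid.End (W.selmerLayer κ m))
    (hσ : ∀ x : W.selmerLayer κ m, ((σ x : W.selmerLayer κ m) : W.subgroupH1 p (κ.layerSubgroup m)) =
      W.conjH1 p (κ.layerSubgroup m) g x)
    (i : ℕ) (x : W.selmerLayer κ m) :
    (((σ ^ i) x : W.selmerLayer κ m) : W.subgroupH1 p (κ.layerSubgroup m)) = W.conjH1 p (κ.layerSubgroup m) (g ^ i) x := by
  induction i with
  | zero => rw [pow_zero, pow_zero, AddMonoid.End.one_apply, W.conjH1_one_holds p (κ.layerSubgroup m), AddMonoidHom.id_apply]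
  | succ i ih =>
      rw [pow_succ', AddMonoid.End.coe_mul, Function.comp_apply, hσ, ih, pow_succ',
        W.conjH1_mul_holds p (κ.layerSubgroup m), AddMonoidHom.comp_apply]

omit [W.IsElliptic] in
/-- **`σ_n^p = 1` on `Sel_{p^∞}(E/K_{n+1})`**: `(γ^{pⁿ})^p = γ^{p^{n+1}} ∈ Gal(K̄/K_{n+1})` acts trivially on `H¹(K_{n+1}, ·)`
(`conjH1_of_mem_holds`, inner automorphisms). Serre, *Local Fields*, VII.§5, Prop. 3. [cite: SerreLocalFields1979, VII.§5 Prop. 3] -/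
theorem layerEnd_pow_prime_eq_one (hγ : κ.IsTopGenerator γ) (n : ℕ) (σ : AddMonoid.End (W.selmerLayer κ (n + 1)))
    (hσ : ∀ x : W.selmerLayer κ (n + 1), ((σ x : W.selmerLayer κ (n + 1)) : W.subgroupH1 p (κ.layerSubgroup (n + 1))) =
      W.conjH1 p (κ.layerSubgroup (n + 1)) (γ ^ p ^ n) x) :
    σ ^ p = 1 := by
  have hmem : (γ ^ p ^ n) ^ p ∈ κ.layerSubgroup (n + 1) := by
    rw [← pow_mul, ← pow_succ]
    exact ZpExtension.pow_mem_layerSubgroup κ hγ (n + 1)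
  refine DFunLike.ext _ _ fun x ↦ Subtype.ext ?_
  rw [coe_layerEnd_pow_apply W p κ σ hσ p x, W.conjH1_of_mem_holds p (κ.layerSubgroup (n + 1)) hmem,
    AddMonoidHom.id_apply, AddMonoid.End.one_apply]

/-! ## §2 `res ∘ cor` is multiplication by `p` on `σ_n`-fixed classes -/

omit [NumberField K] [W.IsElliptic] in
/-- **`res_{K_{n+1}/K_n} ∘ cor_{K_{n+1}/K_n} = Σ_{i<p} conj_{γ^{pⁿ i}}` on `H¹(K_{n+1}, E[p^∞])`** (the norm of
`Gal(K_{n+1}/K_n) = ⟨γ^{pⁿ}⟩`; `resOfLe_coresOfLe_eq_sum` with the representatives `γ^{pⁿ i}`, `i < p`, of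
`bijective_layerCosetRep` — the layer-level form of the tree's `layerToInfty_coresLayer`). Serre, *Galois Cohomology*, I.§2.4.
[cite: SerreGaloisCohomology1997, I.§2.4 (Res, Cor)] -/
theorem resOfLe_coresLayer_eq_sum (hγ : κ.IsTopGenerator γ) (n : ℕ) (t : W.subgroupH1 p (κ.layerSubgroup (n + 1))) :
    W.resOfLe p (κ.layerSubgroup_antitone (Nat.le_succ n)) (W.coresLayer p κ n t) =
      ∑ i ∈ Finset.range p, W.conjH1 p (κ.layerSubgroup (n + 1)) ((γ ^ p ^ n) ^ i) t := by
  letI := κ.finite_layerQuotient_succ n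
  letI : Fintype (κ.layerSubgroup n ⧸ (κ.layerSubgroup (n + 1)).subgroupOf (κ.layerSubgroup n)) :=
    Fintype.ofFinite _
  let e := Equiv.ofBijective _ (κ.bijective_layerCosetRep hγ n)
  have hs : ∀ x, ((κ.layerCosetRep hγ n (e.symm x : Fin p) : κ.layerSubgroup n) :
      κ.layerSubgroup n ⧸ (κ.layerSubgroup (n + 1)).subgroupOf (κ.layerSubgroup n)) = x :=
    fun x ↦ e.apply_symm_apply x
  have h2 : W.resOfLe p (κ.layerSubgroup_antitone (Nat.le_succ n)) (W.coresLayer p κ n t) =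
      ∑ x, W.conjH1 p (κ.layerSubgroup (n + 1))
        ((κ.layerCosetRep hγ n (e.symm x : Fin p) : κ.layerSubgroup n) : Field.absoluteGaloisGroup K) t :=
    resOfLe_coresOfLe_eq_sum (geomPrimaryTorsion W p) (κ.layerSubgroup_antitone (Nat.le_succ n))
      (κ.isOpen_layerSubgroup (n + 1)) hs t
  have hrep : ∀ i : ℕ, ((κ.layerCosetRep hγ n i : κ.layerSubgroup n) : Field.absoluteGaloisGroup K) = (γ ^ p ^ n) ^ i :=
    fun _ ↦ rfl
  rw [h2]
  simp only [hrep]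
  rw [e.symm.sum_comp (fun i : Fin p ↦ W.conjH1 p (κ.layerSubgroup (n + 1)) ((γ ^ p ^ n) ^ (i : ℕ)) t),
    Fin.sum_univ_eq_sum_range (fun i ↦ W.conjH1 p (κ.layerSubgroup (n + 1)) ((γ ^ p ^ n) ^ i) t)]

omit [NumberField K] [W.IsElliptic] in
/-- **On a class fixed by `conj_{γ^{pⁿ}}`, `res (cor t) = p • t`.** Serre, *Galois Cohomology*, I.§2.4 (`res ∘ cor = N`).
[cite: SerreGaloisCohomology1997, I.§2.4 (Res, Cor)] -/
theorem resOfLe_coresLayer_eq_nsmul_of_conjH1_eq (hγ : κ.IsTopGenerator γ) (n : ℕ)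
    (t : W.subgroupH1 p (κ.layerSubgroup (n + 1))) (ht : W.conjH1 p (κ.layerSubgroup (n + 1)) (γ ^ p ^ n) t = t) :
    W.resOfLe p (κ.layerSubgroup_antitone (Nat.le_succ n)) (W.coresLayer p κ n t) = p • t := by
  have hi : ∀ i : ℕ, W.conjH1 p (κ.layerSubgroup (n + 1)) ((γ ^ p ^ n) ^ i) t = t := fun i ↦ by
    rw [conjH1_pow_apply W p]
    exact Function.iterate_fixed ht i
  rw [resOfLe_coresLayer_eq_sum W p κ hγ n t]
  simp only [hi, Finset.sum_const, Finset.card_range]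

/-! ## §3 ONE STEP: `zpCorank Sel_{n+1} ≤ zpCorank Sel_n + zpCorank (ker N_{σ_n})` -/

/-- **The `σ_n`-fixed part of `Sel_{p^∞}(E/K_{n+1})` has corank at most that of `Sel_{p^∞}(E/K_n)`** — via the corestriction
`cor : (Sel_{n+1})^{σ_n} → Sel_n` (`coresLayer_mem_selmerLayer`): its kernel is killed by `p` (`res ∘ cor = p` on fixed classes),
hence finite (`Sel_{n+1}[p]` is finite), and a finite-kernel map does not increase the corank (`zpCorank_le_of_finite_ker`).
NO control theorem / inflation–restriction is used. Greenberg (1999), §1 and §3. [cite: GreenbergLNM1716, §1 pp. 54–57] -/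
theorem zpCorank_fixedSub_le_zpCorank_selmerLayer (hγ : κ.IsTopGenerator γ) (n : ℕ)
    (σ : AddMonoid.End (W.selmerLayer κ (n + 1)))
    (hσ : ∀ x : W.selmerLayer κ (n + 1), ((σ x : W.selmerLayer κ (n + 1)) : W.subgroupH1 p (κ.layerSubgroup (n + 1))) =
      W.conjH1 p (κ.layerSubgroup (n + 1)) (γ ^ p ^ n) x) :
    zpCorank (fixedSub σ) p ≤ zpCorank (W.selmerLayer κ n) p := by
  -- the layers are `p`-primary with finite `p`-torsion
  have hprim1 : ∀ s : W.selmerLayer κ (n + 1), ∃ k : ℕ, p ^ k • s = 0 := exists_pow_nsmul_eq_zero_selmerLayer W κ (n + 1)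
  have hprim0 : ∀ s : W.selmerLayer κ n, ∃ k : ℕ, p ^ k • s = 0 := exists_pow_nsmul_eq_zero_selmerLayer W κ n
  haveI : Finite ((W.selmerLayer κ (n + 1))[(p : ℤ)]) := finite_torsionBy_selmerLayer W (p := p) κ (n + 1)
  haveI : Finite ((W.selmerLayer κ n)[(p : ℤ)]) := finite_torsionBy_selmerLayer W (p := p) κ n
  obtain ⟨hprimF, hfinF⟩ := primary_and_finite_torsionBy_of_injective (p := p) (i := (fixedSub σ).subtype)
    Subtype.val_injective hprim1
  haveI := hfinF
  -- the corestriction restricted to the fixed part, valued in `Sel_n`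
  let cor : fixedSub σ →+ W.selmerLayer κ n :=
    ((W.coresLayer p κ n).comp ((W.selmerLayer κ (n + 1)).subtype.comp (fixedSub σ).subtype)).codRestrict
      (W.selmerLayer κ n) fun x ↦ W.coresLayer_mem_selmerLayer p κ n x.1.2
  have hcor : ∀ x : fixedSub σ, ((cor x : W.selmerLayer κ n) : W.subgroupH1 p (κ.layerSubgroup n)) =
      W.coresLayer p κ n ((x : W.selmerLayer κ (n + 1)) : W.subgroupH1 p (κ.layerSubgroup (n + 1))) := fun _ ↦ rfl
  -- its kernel is killed by `p`: `p • x = res (cor x) = 0`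
  have hker : ∀ x : fixedSub σ, cor x = 0 → p • ((x : fixedSub σ) : W.selmerLayer κ (n + 1)) = 0 := by
    intro x hx
    have hfix : W.conjH1 p (κ.layerSubgroup (n + 1)) (γ ^ p ^ n)
        ((x : W.selmerLayer κ (n + 1)) : W.subgroupH1 p (κ.layerSubgroup (n + 1))) =
        ((x : W.selmerLayer κ (n + 1)) : W.subgroupH1 p (κ.layerSubgroup (n + 1))) := by
      rw [← hσ]
      exact congrArg Subtype.val ((mem_fixedSub_iff σ (x : W.selmerLayer κ (n + 1))).mp x.2)
    have h := resOfLe_coresLayer_eq_nsmul_of_conjH1_eq W p κ hγ n _ hfix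
    rw [← hcor, hx, ZeroMemClass.coe_zero, map_zero] at h
    apply Subtype.ext
    rw [AddSubgroupClass.coe_nsmul, ← h, ZeroMemClass.coe_zero]
  -- hence finite (it embeds into `Sel_{n+1}[p]`)
  haveI : Finite cor.ker := by
    let j : cor.ker → (W.selmerLayer κ (n + 1))[(p : ℤ)] := fun x ↦
      ⟨((x : fixedSub σ) : W.selmerLayer κ (n + 1)),
        AddSubgroup.torsionBy.nsmul_iff.mpr (hker x.1 ((AddMonoidHom.mem_ker).mp x.2))⟩
    refine Finite.of_injective j fun a b hab ↦ ?_
    exact Subtype.ext (Subtype.ext (congrArg (fun z : (W.selmerLayer κ (n + 1))[(p : ℤ)] ↦ (z : W.selmerLayer κ (n + 1))) hab))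
  exact zpCorank_le_of_finite_ker cor hprimF hprim0

/-- ★ **ONE STEP of the tower bound: `zpCorank Sel_{p^∞}(E/K_{n+1}) ≤ zpCorank Sel_{p^∞}(E/K_n) + zpCorank ker N_{σ_n}`**, where
`σ_n = conj_{γ^{pⁿ}}` generates `Gal(K_{n+1}/K_n)` on the layer (`σ_n^p = 1`) and `ker N_{σ_n}`, `N_{σ_n} = Σ_{i<p} σ_n^i =
Φ_{p^{n+1}}(γ)`, is its FAITHFUL part (the tree's `kerNorm σ p`). The cyclic engine `zpCorank_eq_zpCorank_fixedSub_add_zpCorank_kerNorm`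
plus `zpCorank_fixedSub_le_zpCorank_selmerLayer`. Greenberg (1999), §1/§3; Kato (2004), p. 235 (the `χ`-parts).
[cite: GreenbergLNM1716, §1 pp. 54–57] [cite: Kato2004Asterisque, §14 Thm. 14.2 (p. 235)] -/
theorem zpCorank_selmerLayer_succ_le_add_zpCorank_kerNorm (hγ : κ.IsTopGenerator γ) (n : ℕ)
    (σ : AddMonoid.End (W.selmerLayer κ (n + 1)))
    (hσ : ∀ x : W.selmerLayer κ (n + 1), ((σ x : W.selmerLayer κ (n + 1)) : W.subgroupH1 p (κ.layerSubgroup (n + 1))) =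
      W.conjH1 p (κ.layerSubgroup (n + 1)) (γ ^ p ^ n) x) :
    zpCorank (W.selmerLayer κ (n + 1)) p ≤ zpCorank (W.selmerLayer κ n) p + zpCorank (kerNorm σ p) p := by
  have hprim1 : ∀ s : W.selmerLayer κ (n + 1), ∃ k : ℕ, p ^ k • s = 0 := exists_pow_nsmul_eq_zero_selmerLayer W κ (n + 1)
  haveI : Finite ((W.selmerLayer κ (n + 1))[(p : ℤ)]) := finite_torsionBy_selmerLayer W (p := p) κ (n + 1)
  rw [zpCorank_eq_zpCorank_fixedSub_add_zpCorank_kerNorm (layerEnd_pow_prime_eq_one W p κ hγ n σ hσ) hprim1]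
  have h := zpCorank_fixedSub_le_zpCorank_selmerLayer W p κ hγ n σ hσ
  omega

/-! ## §4 TELESCOPED and BOUNDED -/

/-- ★ **TELESCOPED tower bound: `zpCorank Sel_{p^∞}(E/K_n) ≤ zpCorank Sel_{p^∞}(E/K) + Σ_{k<n} zpCorank ker N_{σ_k}`** for any
displayed family `σ_k = conj_{γ^{p^k}}` on `Sel_{k+1}` (binder `hσ`). Iteration of
`zpCorank_selmerLayer_succ_le_add_zpCorank_kerNorm`. Greenberg (1999), §1/§3. [cite: GreenbergLNM1716, §1 pp. 54–57] -/
theorem zpCorank_selmerLayer_le_add_sum_zpCorank_kerNorm (hγ : κ.IsTopGenerator γ)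
    (σ : ∀ k : ℕ, AddMonoid.End (W.selmerLayer κ (k + 1)))
    (hσ : ∀ (k : ℕ) (x : W.selmerLayer κ (k + 1)),
      ((σ k x : W.selmerLayer κ (k + 1)) : W.subgroupH1 p (κ.layerSubgroup (k + 1))) =
        W.conjH1 p (κ.layerSubgroup (k + 1)) (γ ^ p ^ k) x)
    (n : ℕ) :
    zpCorank (W.selmerLayer κ n) p ≤
      zpCorank (W.selmerLayer κ 0) p + ∑ k ∈ Finset.range n, zpCorank (kerNorm (σ k) p) p := by
  induction n with
  | zero => simp
  | succ n ih =>
      have h := zpCorank_selmerLayer_succ_le_add_zpCorank_kerNorm W p κ hγ n (σ n) (hσ n)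
      rw [Finset.sum_range_succ]
      omega

/-- ★★ **BOUNDED CORANK FROM EVENTUALLY FINITE FAITHFUL PARTS.** If for all `k ≥ k₀` the faithful part `ker N_{σ_k}` of
`Sel_{p^∞}(E/K_{k+1})` is finite, then `∃ B, ∀ n, zpCorank Sel_{p^∞}(E/K_n) ≤ B` — the shape of the binder `hKR` of
`OddBlindNF.classicalNoFiniteSubmodule_goodSS_two_of_casselsTateLayerPairing_of_corankBounded` (★★ p823354). For `E/ℚ` along
the cyclotomic tower the hypothesis is Kato Cor. 14.3 (1) on the faithful `χ`-parts + Rohrlich's non-vanishing theorem; neither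
is used here. Greenberg (1999), §1/§3; Kato (2004), Thm. 14.2 / Cor. 14.3 (p. 235); Rohrlich (1984).
[cite: GreenbergLNM1716, §1 pp. 54–57] [cite: Kato2004Asterisque, §14 Thm. 14.2 (p. 235)] -/
theorem exists_forall_zpCorank_selmerLayer_le_of_eventually_finite_kerNorm (hγ : κ.IsTopGenerator γ)
    (σ : ∀ k : ℕ, AddMonoid.End (W.selmerLayer κ (k + 1)))
    (hσ : ∀ (k : ℕ) (x : W.selmerLayer κ (k + 1)),
      ((σ k x : W.selmerLayer κ (k + 1)) : W.subgroupH1 p (κ.layerSubgroup (k + 1))) =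
        W.conjH1 p (κ.layerSubgroup (k + 1)) (γ ^ p ^ k) x)
    (hfin : ∃ k₀ : ℕ, ∀ k : ℕ, k₀ ≤ k → Finite (kerNorm (σ k) p)) :
    ∃ B : ℕ, ∀ n : ℕ, zpCorank (W.selmerLayer κ n) p ≤ B := by
  obtain ⟨k₀, hk₀⟩ := hfin
  refine ⟨zpCorank (W.selmerLayer κ 0) p + ∑ k ∈ Finset.range k₀, zpCorank (kerNorm (σ k) p) p, fun n ↦ ?_⟩
  have hz : ∀ k, k₀ ≤ k → zpCorank (kerNorm (σ k) p) p = 0 := fun k hk ↦ by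
    haveI := hk₀ k hk
    exact zpCorank_of_finite_eq_zero (A := kerNorm (σ k) p) p
  have hsum : ∑ k ∈ Finset.range n, zpCorank (kerNorm (σ k) p) p ≤
      ∑ k ∈ Finset.range k₀, zpCorank (kerNorm (σ k) p) p := by
    calc ∑ k ∈ Finset.range n, zpCorank (kerNorm (σ k) p) p
        = ∑ k ∈ (Finset.range n).filter (· < k₀), zpCorank (kerNorm (σ k) p) p := by
          rw [Finset.sum_filter]
          refine Finset.sum_congr rfl fun k _ ↦ ?_
          by_cases hk : k < k₀
          · rw [if_pos hk]
          · rw [if_neg hk, hz k (not_lt.mp hk)]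
      _ ≤ ∑ k ∈ Finset.range k₀, zpCorank (kerNorm (σ k) p) p :=
          Finset.sum_le_sum_of_subset fun k hk ↦ by
            simp only [Finset.mem_filter, Finset.mem_range] at hk ⊢
            exact hk.2
  exact (zpCorank_selmerLayer_le_add_sum_zpCorank_kerNorm W p κ hγ σ hσ n).trans (by omega)

/-- ★★ **BOUNDED CORANK, displayed WITHOUT the endomorphisms**: if for every `k ≥ k₀` the faithful part
`{x ∈ Sel_{p^∞}(E/K_{k+1}) | Σ_{i<p} conj_{γ^{p^k i}} x = 0}` (the kernel of the norm `Φ_{p^{k+1}}(γ)` of `Gal(K_{k+1}/K_k)`,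
i.e. the `χ`-part for the characters of `Gal(K_{k+1}/K)` of exact order `p^{k+1}`) lies in a finite set, then
`∃ B, ∀ n, zpCorank Sel_{p^∞}(E/K_n) ≤ B`. This is the consumable form for the Kato Cor. 14.3 (1) + Rohrlich road to `hKR`.
Greenberg (1999), §1/§3; Kato (2004), Thm. 14.2 / Cor. 14.3 (p. 235). [cite: GreenbergLNM1716, §1 pp. 54–57]
[cite: Kato2004Asterisque, §14 Thm. 14.2 (p. 235)] -/
theorem exists_forall_zpCorank_selmerLayer_le_of_eventually_finite_faithfulPart (hγ : κ.IsTopGenerator γ)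
    (hfin : ∃ k₀ : ℕ, ∀ k : ℕ, k₀ ≤ k → ∃ S : Set (W.selmerLayer κ (k + 1)), S.Finite ∧
      ∀ x : W.selmerLayer κ (k + 1),
        (∑ i ∈ Finset.range p, W.conjH1 p (κ.layerSubgroup (k + 1)) (γ ^ (p ^ k * i))
          (x : W.subgroupH1 p (κ.layerSubgroup (k + 1)))) = 0 → x ∈ S) :
    ∃ B : ℕ, ∀ n : ℕ, zpCorank (W.selmerLayer κ n) p ≤ B := by
  choose σ hσ using fun k ↦ exists_layerEnd_eq_conjH1 W p κ (γ ^ p ^ k) (k + 1)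
  refine exists_forall_zpCorank_selmerLayer_le_of_eventually_finite_kerNorm W p κ hγ σ hσ ?_
  obtain ⟨k₀, hk₀⟩ := hfin
  refine ⟨k₀, fun k hk ↦ ?_⟩
  obtain ⟨S, hS, hmem⟩ := hk₀ k hk
  have hsub : ∀ x : W.selmerLayer κ (k + 1), x ∈ kerNorm (σ k) p → x ∈ S := fun x hx ↦ by
    apply hmem
    rw [mem_kerNorm_iff, normEnd_apply] at hx
    have h := congrArg (fun z : W.selmerLayer κ (k + 1) ↦ (z : W.subgroupH1 p (κ.layerSubgroup (k + 1)))) hx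
    simp only [AddSubmonoidClass.coe_finsetSum, coe_layerEnd_pow_apply W p κ (σ k) (hσ k), ZeroMemClass.coe_zero,
      ← pow_mul] at h
    exact h
  haveI : Finite S := hS
  exact Finite.of_injective (fun x : kerNorm (σ k) p ↦ (⟨(x : W.selmerLayer κ (k + 1)), hsub x x.2⟩ : S))
    fun a b hab ↦ Subtype.ext (congrArg (fun z : S ↦ (z : W.selmerLayer κ (k + 1))) hab)

end Summit.BirchSwinnertonDyer.BirchSwinnertonDyer.Theorems.TowerCorank

end
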